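import Summits.HodgeConjecture.HodgeConjecture.Theorems.Ring2AbelianAllAndreTransportLattice
import Literature.AlgebraicGeometry.HodgeTheory.GysinTrivialFamilyBaseChange
import Literature.AlgebraicGeometry.HodgeTheory.GysinCleanBaseChange
import Literature.AlgebraicGeometry.HodgeTheory.CurveCorrespondencePushforward
import HarnessLib

/-!
# Ring 2 · sub-cell AbelianAll (ALL ABELIAN VARIETIES), André axis, part XXXII-a — PRODUCT PENCILS: the Gysin padding
# `W ↦ σ_! W` along the slice `σ = (b₀, 𝟙) : 𝒳 ⟶ B × 𝒳` moves a class of the total space of a family `f : 𝒳 ⟶ S` to a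
# class of the product family `B × 𝒳 ⟶ S`, `dim B` degrees up, WITH THE SAME ALGEBRAICITY LOCUS, and `pr_!` brings lifts
# and transports back down — fact-free, for every smooth projective family with smooth projective total space
# (part XXXII-b: hence the André-axis nodes (L), (L∀), (4), (2), (3) ARE THEIR MIDDLE FIBRE DEGREE)

HONEST FRAMING (page 1, verbatim): **research route, not a corollary; conditional on HC_CM plus one named
minimal statement.** Cell line: research route conditional on HC_CM; not a corollary; Q11.4-sentence-2 already
refuted in dim ≥ 3. Nothing in this file proves a case of the Hodge conjecture for an abelian variety; `HC_CM`, `HC_AV`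
do not occur; no node is born (0 `def`), no named fact is used, no `sorry`; axioms standard; nothing is claimed minimal.

## What this part does (brief (ii): "restrict the class of auxiliary varieties / replace B by specific components")

The André-axis `B_min` is the LIFT `(L)_t(p)`: `(j_t^*)⁻¹ Nᵖ(𝒳_t) ≤ Nᵖ(𝒳) ⊔ ker j_t^*` — an algebraic class of the CM
fibre `𝒳_t` which is the restriction of SOME class of the `(d+1)`-fold `𝒳` is the restriction of an ALGEBRAIC class of
`𝒳`. Parts XXIX–XXX settled the degrees `p ≤ 1`, `p ≥ d - 1` and moved the lift UP across the middle (`(L)_t(p) ⟹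
(L)_t(d-p)`, `2p ≤ d`, Lieberman on the fibre). This part moves it DOWN TO the middle of a BIGGER pencil: for a smooth
projective `B` of dimension `r` with a point `b₀`, the product family `pr ≫ f : B × 𝒳 ⟶ S` has fibres `B × 𝒳_s`
(§1: `exists_fiberOver_snd_comp_iso`; it is a compact pencil of abelian varieties of relative dimension `dim B + d` when
`f` is one and `B` is an abelian variety, with the SAME CM points when `B` is of CM type — `isCompactAbelianPencil_snd_comp`,
`cmLocus_subset_cmLocus_snd_comp`), and for the Gysin morphisms `Φ = σ_!`, `Ψ = pr_!` of the slice and the projection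
(the tree's `complexGysin`, relative to any orientation family):

* §2 `snd_gysin_slice_gysin` — `pr_! σ_! = id` (functoriality, `σ ≫ pr = 𝟙`);
  `exists_map_fiberι_snd_gysin_eq_smul` — BASE CHANGE FOR THE PROJECTION `j_s^* pr_! = c · pr'_! (B ◁ j_s)^*` (the tree's
  PROVED `gysin_trivialFamily_baseChange`, Fulton Prop. 1.7), so `pr_!` sends classes dying on / algebraic on the fibre
  `B × 𝒳_s` to classes dying on / algebraic on `𝒳_s`;
  `exists_map_whiskerLeft_slice_gysin_eq_smul` — BASE CHANGE FOR THE SLICE `(B ◁ j_s)^* σ_! = K · σ_{s!} j_s^*` (the tree's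
  PROVED clean-intersection base change `complexGysin_cleanBaseChange`, Fulton Thm. 6.2 (a): the closed immersion
  `(j_s, σ_s) : 𝒳_s ⟶ 𝒳 × (B × 𝒳_s)` exhausts the incidences), so `σ_!` sends classes dying on / algebraic on `𝒳_s` to
  classes dying on / algebraic on `B × 𝒳_s`;
  `map_whiskerLeft_slice_gysin_mem_iff` — hence **`σ_! W` is algebraic on `B × 𝒳_s` iff `W` is algebraic on `𝒳_s`**,
  for EVERY `s`: the two algebraicity loci coincide. The scalars `c`, `K` record the unrelated normalisations of the
  orientation family and never matter (membership in a subspace).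
* §3 for the ACTUAL fibre `(B × 𝒳)_s` (chart `B × 𝒳_s ≅ (B × 𝒳)_s`): `map_fiberι_snd_comp_slice_gysin_mem_iff` (loci
  coincide); **`comap_le_comap_of_snd_comp`** — transport from `t` to `s` in degree `2(p + r)` along `B × 𝒳 ⟶ S` gives
  transport from `t` to `s` in degree `2p` along `f`; **`comap_le_sup_of_snd_comp`** — the LIFT `(L)_t(p + r)` of
  `B × 𝒳 ⟶ S` gives the lift `(L)_t(p)` of `f` (`σ_! W = η + κ` ⟹ `W = pr_! η + pr_! κ`); `comap_eq_sup_of_snd_comp` —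
  the lattice-identity (fixed part) form.

Everything here holds for every smooth projective family `f : 𝒳 ⟶ S` of relative dimension `d` with smooth projective
total space over a separated base and every smooth projective `B` with a complex point — no abelian hypothesis, no
Lefschetz operator, no moving lemma (compare seat b02's padding `W ↦ pr^*(Kʳ ∪ W)` for the transport row
`AbelianSchemeVHC`, `Ring2BindersAbelianSchemeVHCMiddleLift`: it has the same loci but needs Lieberman's `A(𝒳_s)` to come
back and cannot carry the LIFT form down, since inverting `Kʳ ∪ –` on invariant classes relative to `S` is the
`B_min`-type content of parts XXIII–XXVIII; the Gysin padding inverts on the nose, `pr_! σ_! = id`).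

What is NOT claimed: the converse pointwise implications (`(L)_t(p)` for `f` in all degrees does not obviously give
`(L)_t(p + r)` for `B × 𝒳 ⟶ S`: the invariant algebraic classes of `B × 𝒳_t` need not be spanned by products); anything
about `HC_CM`; any case of HC. EDGE LABELS: every row K (kernel, fact-free).

References: Fulton1998 (Prop. 1.7, Thm. 6.2 (a), §19.2); FultonYoungTableaux1997 (App. B §B.1 (4)–(7));
BrosnanFangNiePearlstein2009 (§6 Lemma 48: the padding `X ↦ X × ℙʳ`, here `X ↦ B × X` inside abelian pencils);
Milne2020HodgeClassesAV (Prop. 1, p. 7); Abdulali1994FamiliesAV ((1.1) p. 1122); Andre1996Motifs (§5.1 p. 25, §6.3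
footnote (2) p. 31); Hartshorne1977 (II.3 p. 89, III Prop. 10.1); VoisinHodgeII2003 (§9.2.4 Prop. 9.21 (ii)).
-/

noncomputable section

set_option linter.dupNamespace false

namespace Summit.HodgeConjecture.HodgeConjecture.Ring2.AbelianAll

open CategoryTheory CategoryTheory.Limits AlgebraicGeometry MonoidalCategory CartesianMonoidalCategory
open Literature.AlgebraicGeometry Literature.AlgebraicGeometry.Motives
open Literature.AlgebraicGeometry.HodgeTheory
open Literature.AlgebraicGeometry.Deligne1982 (cmLocus)
open Literature.AlgebraicGeometry.Milne1999 (IsOfCMType)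
open Summit.HodgeConjecture.HodgeConjecture
open Summit.HodgeConjecture.HodgeConjecture.Theses

variable {𝒳 S : SchemeOver ℂ}

/-! ## §1 Product pencils `B × 𝒳 ⟶ S` with a constant smooth projective factor -/

/-- **`(B × 𝒳)_s ≅ B × 𝒳_s`, compatibly with the inclusions into `B × 𝒳`.** [folklore] -/
theorem exists_fiberOver_snd_comp_iso (f : 𝒳 ⟶ S) (B : SchemeOver ℂ) (s : ComplexPoints S) :
    ∃ e : B ⊗ fiberOver f s ≅ fiberOver (snd B 𝒳 ≫ f) s,
      e.hom ≫ fiberι (snd B 𝒳 ≫ f) s = B ◁ fiberι f s := by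
  have hbot : IsPullback (fiberι f s) (fiberOverToSpec f s) f s := familyPullback.isPullback f s
  have htop : IsPullback (B ◁ fiberι f s) (snd B (fiberOver f s)) (snd B 𝒳) (fiberι f s) :=
    (Motives.isPullback_snd_whiskerLeft (fiberι f s) B).flip
  have hbig := htop.paste_vert hbot
  exact ⟨IsPullback.isoIsPullback _ _ hbig (familyPullback.isPullback (snd B 𝒳 ≫ f) s),
    IsPullback.isoIsPullback_hom_fst _ _ _ _⟩

/-- **`B × 𝒳 ⟶ S` is a smooth projective family of relative dimension `dim B + d`.** [folklore] -/
theorem isSmoothProjectiveFamily_snd_comp (f : 𝒳 ⟶ S) {d r : ℕ} (hf : IsSmoothProjectiveFamily f d)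
    {B : SchemeOver ℂ} (hB : IsSmoothProjective r B) : IsSmoothProjectiveFamily (snd B 𝒳 ≫ f) (r + d) := by
  haveI : IsProper f.left := hf.isProper
  haveI : IsProper B.hom := IsSmoothProjective.isProper_holds hB
  haveI := hf.smoothOfRelativeDimension
  refine ⟨?_, ?_, fun s ↦ ?_⟩
  · change SmoothOfRelativeDimension (r + d) (pullback.snd B.hom 𝒳.hom ≫ f.left)
    haveI := smoothOfRelativeDimension_isStableUnderBaseChange (n := r)
    haveI : SmoothOfRelativeDimension r (pullback.snd B.hom 𝒳.hom) :=
      MorphismProperty.pullback_snd (P := @SmoothOfRelativeDimension r) _ _ hB.smoothOfRelativeDimension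
    infer_instance
  · change IsProper (pullback.snd B.hom 𝒳.hom ≫ f.left)
    infer_instance
  · obtain ⟨e, -⟩ := exists_fiberOver_snd_comp_iso f B s
    exact (IsSmoothProjective.tensor_holds hB (hf.isSmoothProjective s)).of_iso e

/-- **The product `B × 𝒳 ⟶ S` of a compact pencil of abelian varieties with an abelian variety `B` is a compact pencil
of abelian varieties of relative dimension `dim B + d`.** [folklore] -/
theorem isCompactAbelianPencil_snd_comp {f : 𝒳 ⟶ S} {d : ℕ} (hf : IsCompactAbelianPencil f d)
    (B : AbelianVariety ℂ) : IsCompactAbelianPencil (snd B.X 𝒳 ≫ f) (B.dim + d) := by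
  have hB : IsSmoothProjective B.dim B.X := AbelianVariety.isSmoothProjective_holds
  obtain ⟨e, he⟩ := hf.exists_section
  have htot : IsSmoothProjective (B.dim + d + 1) (B.X ⊗ 𝒳) := by
    rw [Nat.add_assoc]
    exact IsSmoothProjective.tensor_holds hB hf.isSmoothProjective_total
  refine .of_section (lift (toSpecOver S ≫ (1 : B.Points ℂ)) e) ?_ hf.isSmoothProjective_base htot
    (isSmoothProjectiveFamily_snd_comp f hf.isSmoothProjectiveFamily hB) fun s ↦ ?_
  · rw [lift_snd_assoc, he]
  · obtain ⟨A, ⟨eA⟩⟩ := hf.exists_abelianVariety_fiber s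
    obtain ⟨e', -⟩ := exists_fiberOver_snd_comp_iso f B.X s
    exact ⟨B.prod A, ⟨whiskerLeftIso B.X eA ≪≫ e'⟩⟩

/-- **The CM locus only grows**: a CM fibre `𝒳_t ≅ A₀` of `f` gives the CM fibre `B × A₀` of `B × 𝒳 ⟶ S` when `B` is
of CM type. [folklore] -/
theorem cmLocus_subset_cmLocus_snd_comp (f : 𝒳 ⟶ S) {n : ℕ} (B : AbelianVariety ℂ) (hB : IsOfCMType B) :
    cmLocus f n ⊆ cmLocus (snd B.X 𝒳 ≫ f) (B.dim + n) := by
  rintro t ⟨A₀, ⟨e₀⟩, hdim₀, hcm₀⟩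
  obtain ⟨e, -⟩ := exists_fiberOver_snd_comp_iso f B.X t
  exact ⟨B.prod A₀, ⟨whiskerLeftIso B.X e₀ ≪≫ e⟩, by rw [AbelianVariety.dim_prod, hdim₀], hB.prod hcm₀⟩

/-! ## §2 The Gysin padding `Φ = σ_!`, `Ψ = pr_!` on a smooth projective family with smooth projective total space -/

section Engine

variable {N d r : ℕ} {f : 𝒳 ⟶ S} (μ : OrientationFamily) (hX : IsSmoothProjective N 𝒳)
  (hf : IsSmoothProjectiveFamily f d) {B : SchemeOver ℂ} (hB : IsSmoothProjective r B) (b₀ : ComplexPoints B)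

/-- **`pr_! σ_! = id`**: the slice `σ = (b₀, 𝟙) : 𝒳 ⟶ B × 𝒳` followed by the projection is the identity, and the Gysin
morphisms are functorial. [folklore] -/
theorem snd_gysin_slice_gysin (p : ℕ) (W : complexBetti 𝒳 (2 * p)) :
    complexGysin μ (IsSmoothProjective.tensor_holds hB hX) hX (snd B 𝒳)
        (show 2 * (p + r) + 2 * N = 2 * p + 2 * (r + N) by omega)
      (complexGysin μ hX (IsSmoothProjective.tensor_holds hB hX) (lift (toSpecOver 𝒳 ≫ b₀) (𝟙 𝒳))
        (show 2 * p + 2 * (r + N) = 2 * (p + r) + 2 * N by omega) W) = W := by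
  have hμ : μ.HasPoincareDuality := OrientationFamily.hasPoincareDuality μ
  rw [← LinearMap.comp_apply, ← complexGysin_comp hμ hX (IsSmoothProjective.tensor_holds hB hX) hX
    (lift (toSpecOver 𝒳 ≫ b₀) (𝟙 𝒳)) (snd B 𝒳)
    (show 2 * p + 2 * (r + N) = 2 * (p + r) + 2 * N by omega)
    (show 2 * (p + r) + 2 * N = 2 * p + 2 * (r + N) by omega)]
  simp only [lift_snd]
  rw [complexGysin_id hμ hX, LinearMap.id_apply]

include hf

/-- **Base change for the projection** (the cartesian square `B × 𝒳_s ⟶ B × 𝒳` over `𝒳_s ⟶ 𝒳`): restricting `pr_! u`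
to the fibre `𝒳_s` is, up to ONE scalar, pushing the restriction `(B ◁ j_s)^* u` forward along `pr : B × 𝒳_s ⟶ 𝒳_s`
(the tree's `gysin_trivialFamily_baseChange`, Fulton Prop. 1.7). [cite: Fulton1998, Prop. 1.7 and §19.2] -/
theorem exists_map_fiberι_snd_gysin_eq_smul (s : ComplexPoints S) :
    ∃ c : ℂ, ∀ ⦃k k₁ : ℕ⦄ (hk : k + 2 * N = k₁ + 2 * (r + N)) (u : complexBetti (B ⊗ 𝒳) k),
      complexBetti.map (fiberι f s) k₁
          (complexGysin μ (IsSmoothProjective.tensor_holds hB hX) hX (snd B 𝒳) hk u) =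
        c • complexGysin μ (IsSmoothProjective.tensor_holds hB (hf.isSmoothProjective s)) (hf.isSmoothProjective s)
          (snd B (fiberOver f s)) (show k + 2 * d = k₁ + 2 * (r + d) by omega)
          (complexBetti.map (B ◁ fiberι f s) k u) :=
  gysin_trivialFamily_baseChange μ hB hX (hf.isSmoothProjective s) (fiberι f s)

/-- `pr_!` maps the classes dying on the fibre `(B × 𝒳)_s = B × 𝒳_s` into the classes dying on `𝒳_s`. [cite: Fulton1998, Prop. 1.7] -/
theorem map_fiberι_snd_gysin_eq_zero (s : ComplexPoints S) {k k₁ : ℕ} (hk : k + 2 * N = k₁ + 2 * (r + N))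
    {u : complexBetti (B ⊗ 𝒳) k} (hu : complexBetti.map (B ◁ fiberι f s) k u = 0) :
    complexBetti.map (fiberι f s) k₁ (complexGysin μ (IsSmoothProjective.tensor_holds hB hX) hX (snd B 𝒳) hk u) = 0 := by
  obtain ⟨c, hc⟩ := exists_map_fiberι_snd_gysin_eq_smul μ hX hf hB s
  rw [hc hk u, hu, map_zero, smul_zero]

/-- `pr_!` maps a class ALGEBRAIC on the fibre `B × 𝒳_s` to a class algebraic on `𝒳_s` (base change, then the Gysin
morphism of `pr : B × 𝒳_s ⟶ 𝒳_s` preserves algebraic classes). [cite: Fulton1998, Prop. 1.7] [cite: VoisinHodgeII2003, §9.2.4 Prop. 9.21 (ii)] -/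
theorem map_fiberι_snd_gysin_mem_algebraicClasses (s : ComplexPoints S) {p : ℕ} {u : complexBetti (B ⊗ 𝒳) (2 * (p + r))}
    (hu : complexBetti.map (B ◁ fiberι f s) (2 * (p + r)) u ∈ algebraicClasses (B ⊗ fiberOver f s) (p + r)) :
    complexBetti.map (fiberι f s) (2 * p)
        (complexGysin μ (IsSmoothProjective.tensor_holds hB hX) hX (snd B 𝒳)
          (show 2 * (p + r) + 2 * N = 2 * p + 2 * (r + N) by omega) u) ∈
      algebraicClasses (fiberOver f s) p := by
  obtain ⟨c, hc⟩ := exists_map_fiberι_snd_gysin_eq_smul μ hX hf hB s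
  rw [hc]
  exact Submodule.smul_mem _ c
    (complexGysin_mem_algebraicClasses_of_mem_algebraicClasses μ
      (IsSmoothProjective.tensor_holds hB (hf.isSmoothProjective s)) (hf.isSmoothProjective s) (snd B (fiberOver f s))
      (show 2 * (p + r) + 2 * d = 2 * p + 2 * (r + d) by omega) hu)

variable [IsSeparated S.hom]

/-- **Base change for the slice** (the cartesian square `𝒳_s ⟶ 𝒳` over `B × 𝒳_s ⟶ B × 𝒳`, slices `σ = (b₀, 𝟙)`):
restricting `σ_! y` to `B × 𝒳_s` is, up to ONE scalar, `σ_{s!}(j_s^* y)` — the tree's clean-intersection base change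
`complexGysin_cleanBaseChange` (Fulton Thm. 6.2 (a)): `(j_s, σ_s) : 𝒳_s ⟶ 𝒳 × (B × 𝒳_s)` is a closed immersion whose
complex points are exactly the incidences `σ(P) = (B ◁ j_s)(Q)`. [cite: Fulton1998, Thm. 6.2 (a) and Prop. 1.7] -/
theorem exists_map_whiskerLeft_slice_gysin_eq_smul (s : ComplexPoints S) :
    ∃ K : ℂ, ∀ ⦃a b : ℕ⦄ (hab : a + 2 * (r + N) = b + 2 * N) (y : complexBetti 𝒳 a),
      complexBetti.map (B ◁ fiberι f s) b
          (complexGysin μ hX (IsSmoothProjective.tensor_holds hB hX) (lift (toSpecOver 𝒳 ≫ b₀) (𝟙 𝒳)) hab y) =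
        K • complexGysin μ (hf.isSmoothProjective s) (IsSmoothProjective.tensor_holds hB (hf.isSmoothProjective s))
          (lift (toSpecOver (fiberOver f s) ≫ b₀) (𝟙 (fiberOver f s)))
          (show a + 2 * (r + d) = b + 2 * d by omega) (complexBetti.map (fiberι f s) a y) := by
  have hXs : IsSmoothProjective d (fiberOver f s) := hf.isSmoothProjective s
  haveI : IsClosedImmersion (fiberι f s).left := by
    haveI : IsClosedImmersion s.left := Motives.CurveNet.isClosedImmersion_left_of_isSeparated s
    rw [fiberι_left]
    exact MorphismProperty.pullback_fst (P := @IsClosedImmersion) _ _ inferInstance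
  haveI := isClosedImmersion_lift_left_of_isSmoothProjective (IsSmoothProjective.tensor_holds hB hXs) (fiberι f s)
    (lift (toSpecOver (fiberOver f s) ≫ b₀) (𝟙 (fiberOver f s)))
  refine complexGysin_cleanBaseChange μ hX (IsSmoothProjective.tensor_holds hB hX)
    (IsSmoothProjective.tensor_holds hB hXs) hXs (lift (toSpecOver 𝒳 ≫ b₀) (𝟙 𝒳)) (B ◁ fiberι f s) (fiberι f s)
    (lift (toSpecOver (fiberOver f s) ≫ b₀) (𝟙 (fiberOver f s))) (by omega) fun P Q hPQ ↦ ?_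
  refine ⟨AlgPoints.map (snd B (fiberOver f s)) Q, ?_, ?_⟩
  · have h := congrArg (AlgPoints.map (snd B 𝒳)) hPQ
    rw [← AlgPoints.map_comp_apply, lift_snd, AlgPoints.map_id_apply, ← AlgPoints.map_comp_apply, whiskerLeft_snd,
      AlgPoints.map_comp_apply] at h
    exact h.symm
  · apply AlgPoints.prodEquiv.injective
    refine Prod.ext ?_ ?_
    · have h := congrArg (AlgPoints.map (fst B 𝒳)) hPQ
      rw [← AlgPoints.map_comp_apply, lift_fst, ← AlgPoints.map_comp_apply, whiskerLeft_fst,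
        AlgPoints.map_comp_apply] at h
      rw [AlgPoints.prodEquiv_apply_fst, AlgPoints.prodEquiv_apply_fst, ← AlgPoints.map_comp_apply, lift_fst,
        AlgPoints.map_comp_apply, ← h, Motives.eq_toSpecOver (AlgPoints.map (toSpecOver (fiberOver f s)) _),
        Motives.eq_toSpecOver (AlgPoints.map (toSpecOver 𝒳) P)]
    · rw [AlgPoints.prodEquiv_apply_snd, AlgPoints.prodEquiv_apply_snd, ← AlgPoints.map_comp_apply, lift_snd,
        AlgPoints.map_id_apply]

/-- `σ_!` maps the classes dying on `𝒳_s` into the classes dying on `B × 𝒳_s`. [cite: Fulton1998, Thm. 6.2 (a)] -/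
theorem map_whiskerLeft_slice_gysin_eq_zero (s : ComplexPoints S) {a b : ℕ} (hab : a + 2 * (r + N) = b + 2 * N)
    {y : complexBetti 𝒳 a} (hy : complexBetti.map (fiberι f s) a y = 0) :
    complexBetti.map (B ◁ fiberι f s) b
        (complexGysin μ hX (IsSmoothProjective.tensor_holds hB hX) (lift (toSpecOver 𝒳 ≫ b₀) (𝟙 𝒳)) hab y) = 0 := by
  obtain ⟨K, hK⟩ := exists_map_whiskerLeft_slice_gysin_eq_smul μ hX hf hB b₀ s
  rw [hK hab y, hy, map_zero, smul_zero]

/-- `σ_!` maps a class algebraic on `𝒳_s` to a class algebraic on `B × 𝒳_s`. [cite: Fulton1998, Thm. 6.2 (a)]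
[cite: VoisinHodgeII2003, §9.2.4 Prop. 9.21 (ii)] -/
theorem map_whiskerLeft_slice_gysin_mem_algebraicClasses (s : ComplexPoints S) {p : ℕ} {y : complexBetti 𝒳 (2 * p)}
    (hy : complexBetti.map (fiberι f s) (2 * p) y ∈ algebraicClasses (fiberOver f s) p) :
    complexBetti.map (B ◁ fiberι f s) (2 * (p + r))
        (complexGysin μ hX (IsSmoothProjective.tensor_holds hB hX) (lift (toSpecOver 𝒳 ≫ b₀) (𝟙 𝒳))
          (show 2 * p + 2 * (r + N) = 2 * (p + r) + 2 * N by omega) y) ∈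
      algebraicClasses (B ⊗ fiberOver f s) (p + r) := by
  obtain ⟨K, hK⟩ := exists_map_whiskerLeft_slice_gysin_eq_smul μ hX hf hB b₀ s
  rw [hK]
  exact Submodule.smul_mem _ K
    (complexGysin_mem_algebraicClasses_of_mem_algebraicClasses μ (hf.isSmoothProjective s)
      (IsSmoothProjective.tensor_holds hB (hf.isSmoothProjective s)) (lift (toSpecOver (fiberOver f s) ≫ b₀) (𝟙 _))
      (show 2 * p + 2 * (r + d) = 2 * (p + r) + 2 * d by omega) hy)

/-- **THE TWO ALGEBRAICITY LOCI COINCIDE**: for every `s`, `σ_! W` is algebraic on `B × 𝒳_s` iff `W` is algebraic on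
`𝒳_s` (`⟸`: base change for the slice; `⟹`: `W = pr_! σ_! W` and base change for the projection). No Lefschetz
operator, no moving lemma, no named fact. [cite: Fulton1998, Prop. 1.7 and Thm. 6.2 (a)] [cite: BrosnanFangNiePearlstein2009, §6 Lemma 48] -/
theorem map_whiskerLeft_slice_gysin_mem_iff (s : ComplexPoints S) (p : ℕ) (W : complexBetti 𝒳 (2 * p)) :
    complexBetti.map (B ◁ fiberι f s) (2 * (p + r))
        (complexGysin μ hX (IsSmoothProjective.tensor_holds hB hX) (lift (toSpecOver 𝒳 ≫ b₀) (𝟙 𝒳))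
          (show 2 * p + 2 * (r + N) = 2 * (p + r) + 2 * N by omega) W) ∈
        algebraicClasses (B ⊗ fiberOver f s) (p + r) ↔
      complexBetti.map (fiberι f s) (2 * p) W ∈ algebraicClasses (fiberOver f s) p := by
  refine ⟨fun h ↦ ?_, map_whiskerLeft_slice_gysin_mem_algebraicClasses μ hX hf hB b₀ s⟩
  have h' := map_fiberι_snd_gysin_mem_algebraicClasses μ hX hf hB s h
  rwa [snd_gysin_slice_gysin μ hX hB b₀] at h'

end Engine

/-! ## §3 Pointwise consequences for the product family `pr ≫ f : B × 𝒳 ⟶ S` -/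

section Pointwise

variable {N d r : ℕ} {f : 𝒳 ⟶ S} (hX : IsSmoothProjective N 𝒳) (hf : IsSmoothProjectiveFamily f d)
  {B : SchemeOver ℂ} (hB : IsSmoothProjective r B) (b₀ : ComplexPoints B)

/-- Reading algebraicity on the fibre `(B × 𝒳)_s` through the chart `B × 𝒳_s ≅ (B × 𝒳)_s`. [folklore] -/
theorem map_fiberι_snd_comp_mem_iff_whiskerLeft (f : 𝒳 ⟶ S) (B : SchemeOver ℂ) (s : ComplexPoints S) {q : ℕ}
    (u : complexBetti (B ⊗ 𝒳) (2 * q)) :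
    complexBetti.map (fiberι (snd B 𝒳 ≫ f) s) (2 * q) u ∈ algebraicClasses (fiberOver (snd B 𝒳 ≫ f) s) q ↔
      complexBetti.map (B ◁ fiberι f s) (2 * q) u ∈ algebraicClasses (B ⊗ fiberOver f s) q := by
  obtain ⟨e, he⟩ := exists_fiberOver_snd_comp_iso f B s
  rw [← he, complexBetti.map_comp_apply', mem_algebraicClasses_map_iff_of_iso e]

/-- Reading vanishing on the fibre `(B × 𝒳)_s` through the chart `B × 𝒳_s ≅ (B × 𝒳)_s`. [folklore] -/
theorem map_fiberι_snd_comp_eq_zero_iff_whiskerLeft (f : 𝒳 ⟶ S) (B : SchemeOver ℂ) (s : ComplexPoints S) {k : ℕ}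
    (u : complexBetti (B ⊗ 𝒳) k) :
    complexBetti.map (fiberι (snd B 𝒳 ≫ f) s) k u = 0 ↔ complexBetti.map (B ◁ fiberι f s) k u = 0 := by
  obtain ⟨e, he⟩ := exists_fiberOver_snd_comp_iso f B s
  rw [← he, complexBetti.map_comp_apply']
  refine ⟨fun h ↦ by rw [h, map_zero], fun h ↦ (complexBetti.bijective_map_of_iso e k).1 ?_⟩
  rw [h, map_zero]

variable [IsSeparated S.hom]

include hf in
/-- **THE ALGEBRAICITY LOCI OF `W` (for `f`) AND OF `σ_! W` (for `pr ≫ f : B × 𝒳 ⟶ S`) COINCIDE**, as subsets of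
`S(ℂ)`, for every smooth projective family `f` with smooth projective total space over a separated base, every smooth
projective `B` with a complex point `b₀`, every degree: `σ_! W|_{(B × 𝒳)_s}` is algebraic iff `W|_{𝒳_s}` is.
FACT-FREE. [cite: Fulton1998, Prop. 1.7 and Thm. 6.2 (a)] [cite: BrosnanFangNiePearlstein2009, §6 Lemma 48] -/
theorem map_fiberι_snd_comp_slice_gysin_mem_iff (μ : OrientationFamily) (s : ComplexPoints S) (p : ℕ)
    (W : complexBetti 𝒳 (2 * p)) :
    complexBetti.map (fiberι (snd B 𝒳 ≫ f) s) (2 * (p + r))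
        (complexGysin μ hX (IsSmoothProjective.tensor_holds hB hX) (lift (toSpecOver 𝒳 ≫ b₀) (𝟙 𝒳))
          (show 2 * p + 2 * (r + N) = 2 * (p + r) + 2 * N by omega) W) ∈
        algebraicClasses (fiberOver (snd B 𝒳 ≫ f) s) (p + r) ↔
      complexBetti.map (fiberι f s) (2 * p) W ∈ algebraicClasses (fiberOver f s) p := by
  rw [map_fiberι_snd_comp_mem_iff_whiskerLeft, map_whiskerLeft_slice_gysin_mem_iff μ hX hf hB b₀]

include hX hf hB b₀ in
/-- **TRANSPORT along the product family in degree `2(p + r)` gives transport along `f` in degree `2p`** (same two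
points `t`, `s`): if every class of `B × 𝒳` algebraic on `(B × 𝒳)_t` is algebraic on `(B × 𝒳)_s`, then every class of
`𝒳` algebraic on `𝒳_t` is algebraic on `𝒳_s`. FACT-FREE. [cite: Fulton1998, Prop. 1.7 and Thm. 6.2 (a)]
[cite: Abdulali1994FamiliesAV, (1.1) (p. 1122)] -/
theorem comap_le_comap_of_snd_comp {t s : ComplexPoints S} {p : ℕ}
    (h : (algebraicClasses (fiberOver (snd B 𝒳 ≫ f) t) (p + r)).comap
        (complexBetti.map (fiberι (snd B 𝒳 ≫ f) t) (2 * (p + r))).hom ≤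
      (algebraicClasses (fiberOver (snd B 𝒳 ≫ f) s) (p + r)).comap
        (complexBetti.map (fiberι (snd B 𝒳 ≫ f) s) (2 * (p + r))).hom) :
    (algebraicClasses (fiberOver f t) p).comap (complexBetti.map (fiberι f t) (2 * p)).hom ≤
      (algebraicClasses (fiberOver f s) p).comap (complexBetti.map (fiberι f s) (2 * p)).hom := fun W hW ↦
  let μ : OrientationFamily := fun _ _ h ↦ (Motives.ComplexPoints.isOrientableOver ℂ h).some
  (map_fiberι_snd_comp_slice_gysin_mem_iff hX hf hB b₀ μ s p W).1
    (h ((map_fiberι_snd_comp_slice_gysin_mem_iff hX hf hB b₀ μ t p W).2 hW))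

include hX hf hB b₀ in
/-- **THE LIFT `(L)_t(p + r)` of the product family gives the lift `(L)_t(p)` of `f`** (lattice form, same point `t`):
if `(j'_t^*)⁻¹ N^{p+r}((B × 𝒳)_t) ≤ N^{p+r}(B × 𝒳) ⊔ ker j'_t^*` then `(j_t^*)⁻¹ Nᵖ(𝒳_t) ≤ Nᵖ(𝒳) ⊔ ker j_t^*`:
for `W` algebraic on `𝒳_t`, `σ_! W` is algebraic on `(B × 𝒳)_t`, so `σ_! W = η + κ` with `η` algebraic on `B × 𝒳` and
`κ` dying on `(B × 𝒳)_t`; then `W = pr_! σ_! W = pr_! η + pr_! κ` with `pr_! η` algebraic on `𝒳` and `pr_! κ` dying on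
`𝒳_t` (base change). FACT-FREE. [cite: Fulton1998, Prop. 1.7 and Thm. 6.2 (a)] [cite: Milne2020HodgeClassesAV, Prop. 1 (p. 7)] -/
theorem comap_le_sup_of_snd_comp {t : ComplexPoints S} {p : ℕ}
    (h : (algebraicClasses (fiberOver (snd B 𝒳 ≫ f) t) (p + r)).comap
        (complexBetti.map (fiberι (snd B 𝒳 ≫ f) t) (2 * (p + r))).hom ≤
      algebraicClasses (B ⊗ 𝒳) (p + r) ⊔ LinearMap.ker (complexBetti.map (fiberι (snd B 𝒳 ≫ f) t) (2 * (p + r))).hom) :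
    (algebraicClasses (fiberOver f t) p).comap (complexBetti.map (fiberι f t) (2 * p)).hom ≤
      algebraicClasses 𝒳 p ⊔ LinearMap.ker (complexBetti.map (fiberι f t) (2 * p)).hom := by
  intro W hW
  let μ : OrientationFamily := fun _ _ h ↦ (Motives.ComplexPoints.isOrientableOver ℂ h).some
  obtain ⟨η, hη, κ, hκ, hsum⟩ :=
    Submodule.mem_sup.1 (h ((map_fiberι_snd_comp_slice_gysin_mem_iff hX hf hB b₀ μ t p W).2 hW))
  rw [← snd_gysin_slice_gysin μ hX hB b₀ p W, ← hsum, map_add]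
  refine Submodule.add_mem_sup ?_ ?_
  · exact complexGysin_mem_algebraicClasses_of_mem_algebraicClasses μ (IsSmoothProjective.tensor_holds hB hX) hX
      (snd B 𝒳) _ hη
  · rw [LinearMap.mem_ker] at hκ ⊢
    exact map_fiberι_snd_gysin_eq_zero μ hX hf hB t _
      ((map_fiberι_snd_comp_eq_zero_iff_whiskerLeft f B t κ).1 hκ)

include hX hf hB b₀ in
/-- **The algebraic fixed part in degree `2(p + r)` on the product family gives it in degree `2p` on `f`** (lattice
identity form at the point `t`), granted that algebraic classes of `𝒳` restrict to algebraic classes of `𝒳_t` (a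
hypothesis here; the tree's theorem `map_fiberι_mem_algebraicClasses` on quasi-projective carriers).
FACT-FREE. [cite: Milne2020HodgeClassesAV, Prop. 1 (p. 7)] [cite: Fulton1998, Prop. 1.7 and §10.1] -/
theorem comap_eq_sup_of_snd_comp {t : ComplexPoints S} {p : ℕ}
    (hres : ∀ η ∈ algebraicClasses 𝒳 p, complexBetti.map (fiberι f t) (2 * p) η ∈ algebraicClasses (fiberOver f t) p)
    (h : (algebraicClasses (fiberOver (snd B 𝒳 ≫ f) t) (p + r)).comap
        (complexBetti.map (fiberι (snd B 𝒳 ≫ f) t) (2 * (p + r))).hom =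
      algebraicClasses (B ⊗ 𝒳) (p + r) ⊔ LinearMap.ker (complexBetti.map (fiberι (snd B 𝒳 ≫ f) t) (2 * (p + r))).hom) :
    (algebraicClasses (fiberOver f t) p).comap (complexBetti.map (fiberι f t) (2 * p)).hom =
      algebraicClasses 𝒳 p ⊔ LinearMap.ker (complexBetti.map (fiberι f t) (2 * p)).hom := by
  refine le_antisymm (comap_le_sup_of_snd_comp hX hf hB b₀ h.le) (sup_le (fun η hη ↦ hres η hη) fun κ hκ ↦ ?_)
  rw [LinearMap.mem_ker] at hκ
  change complexBetti.map (fiberι f t) (2 * p) κ ∈ algebraicClasses (fiberOver f t) p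
  rw [hκ]
  exact Submodule.zero_mem _

end Pointwise

end Summit.HodgeConjecture.HodgeConjecture.Ring2.AbelianAll

end
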